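import Literature.Topology.FourManifolds.CircleSurgeryExistence
import Literature.Topology.FourManifolds.CircleLoops
import Literature.Topology.FourManifolds.KnotFraming
import HarnessLib

/-!
# Descending an equivariant tube reparametrisation to `S¹ × ℝ³`

Helper `helper_foldNF_descend` of stub `helper_sliceGluing_foldNormalForm` (the `S¹`-parametric
fold normal form of the round circle), line `Sketch`, crux `SblfDescent.RungOne`.

(Crux item stmt-SmoothPoincare4-18531; skeleton `Cruxes/RungOne/Lines/Sketch.lean`.)

Let `ν₀ : S¹ × ℝ³ ↪ X` be a tubular neighbourhood of a circle `e` in a `4`-manifold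
(`CircleNbhd`), and let `Ψ, Φ : ℝ × ℝ³ → ℝ × ℝ³` be `C^∞` on uniform tubes, EQUIVARIANT under the
deck translation `t ↦ t + 1` of the universal cover `ℝ → S¹`, `t ↦ circlePt t = (cos 2πt, sin 2πt)`,
with `Ψ ∘ Φ = id` on `ℝ × B(0, ε)` and `Φ (ℝ × B(0, ε))` open (the output of the periodic tube
inverse function theorem `helper_foldNF_tubeIFT`).  Then `Φ` descends to `S¹ × B(0, ε)` and
`ν = ν₀ ∘ Φ̄` is a new tube parametrisation: `ν (circlePt s, y) = ν₀ (circlePt (Φ (s, y)).1,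
(Φ (s, y)).2)`, `C^∞` and injective on `S¹ × B(0, ε)`, with open image and injective
differential.  Smoothness descends along the covering through the smooth local angle
functions `angA`, `angB` (`TorusCoordinates.lean`); injectivity of `ν` and of its differential
come from the smooth LEFT INVERSE `Ψ̄ ∘ ν₀⁻¹` (no differential on `S¹` is ever computed).

## References

* M. W. Hirsch, *Differential Topology*, GTM 33 (1976), Ch. 1 §1 (the circle as `ℝ/ℤ`),
  Ch. 4 §5 (tubular neighbourhoods). [HirschDT1976]
-/

set_option linter.dupNamespace false

noncomputable section

open scoped Manifold ContDiff Topology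
open Set Function Filter Metric Literature.Topology.FourManifolds

namespace Summit.SmoothPoincare4.SmoothPoincare4.Cruxes.RungOne.Sketch

/-- Local notation: `𝔼 n` is the model Euclidean space `EuclideanSpace ℝ (Fin n)`. -/
local notation "𝔼 " n:arg => EuclideanSpace ℝ (Fin n)

/-- Local notation: `𝕊¹`, the unit circle of `ℝ²`. -/
local notation "𝕊¹" => (Metric.sphere (0 : EuclideanSpace ℝ (Fin 2)) (1 : ℝ))

/-! ### Periodic maps on `ℝ × Y` and the covering `circlePt × id` -/

/-- **Integral iterates of a `1`-periodicity in the first variable.** [folklore] -/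
theorem apply_add_int_of_periodic {Y Z : Type*} {M : ℝ × Y → Z}
    (hper : ∀ (t : ℝ) (y : Y), M (t + 1, y) = M (t, y)) (m : ℤ) (t : ℝ) (y : Y) :
    M (t + m, y) = M (t, y) := by
  have hp : Periodic (fun s : ℝ => M (s, y)) 1 := fun s => hper s y
  have := (hp.int_mul m) t
  simpa using this

/-- A map `1`-periodic in the first variable takes equal values over equal points of the circle.
[folklore] -/
theorem apply_eq_of_circlePt_eq' {Y Z : Type*} {M : ℝ × Y → Z}
    (hper : ∀ (t : ℝ) (y : Y), M (t + 1, y) = M (t, y)) {s u : ℝ} (h : circlePt s = circlePt u)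
    (y : Y) : M (s, y) = M (u, y) := by
  obtain ⟨m, rfl⟩ := circlePt_eq_circlePt_iff.1 h
  exact apply_add_int_of_periodic hper m u y

/-- **Integral iterates of an equivariance valid on a sub-tube.**  If
`Φ (s + 1, y) = Φ (s, y) + (1, 0)` for all `s` and all `y ∈ A`, then
`Φ (s + m, y) = Φ (s, y) + (m, 0)` for `m ∈ ℤ`, `y ∈ A`. [folklore] -/
theorem apply_add_int_of_equivariant_on {F : Type*} [AddCommGroup F] {Φ : ℝ × F → ℝ × F}
    {A : Set F} (hper : ∀ (s : ℝ) (y : F), y ∈ A → Φ (s + 1, y) = Φ (s, y) + (1, 0)) (m : ℤ)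
    (s : ℝ) {y : F} (hy : y ∈ A) : Φ (s + m, y) = Φ (s, y) + ((m : ℝ), 0) := by
  induction m using Int.induction_on generalizing s with
  | zero => simp
  | succ n ih =>
    have h1 : s + ((n : ℤ) + 1 : ℤ) = (s + (n : ℤ)) + 1 := by push_cast; ring
    have h2 : (((n : ℤ) : ℝ), (0 : F)) + (1, 0) = ((((n : ℤ) + 1 : ℤ) : ℝ), 0) := by
      ext <;> simp
    rw [h1, hper _ _ hy, ih, add_assoc, h2]
  | pred n ih =>
    have h1 : s + (-(n : ℤ) : ℤ) = (s + (-(n : ℤ) - 1 : ℤ)) + 1 := by push_cast; ring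
    have h2 : (((-(n : ℤ) : ℤ) : ℝ), (0 : F)) = (((-(n : ℤ) - 1 : ℤ) : ℝ), (0 : F)) + (1, 0) := by
      ext <;> simp
    have key := ih s
    rw [h1, hper _ _ hy, h2, ← add_assoc] at key
    exact add_right_cancel key

/-- The covering `(t, y) ↦ (circlePt t, y) : ℝ × ℝ³ → S¹ × ℝ³` is `C^∞`. [folklore] -/
theorem contMDiff_circlePt_prod :
    ContMDiff 𝓘(ℝ, ℝ × 𝔼 3) ((𝓡 1).prod 𝓘(ℝ, 𝔼 3)) ∞
      fun q : ℝ × 𝔼 3 => ((circlePt q.1, q.2) : 𝕊¹ × 𝔼 3) :=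
  (contMDiff_circlePt.comp contDiff_fst.contMDiff).prodMk contDiff_snd.contMDiff

/-- The covering `(t, y) ↦ (circlePt t, y)` is an open map. [folklore] -/
theorem isOpenMap_circlePt_prod :
    IsOpenMap fun q : ℝ × 𝔼 3 => ((circlePt q.1, q.2) : 𝕊¹ × 𝔼 3) := by
  have h2π : (2 * Real.pi : ℝ) ≠ 0 := by positivity
  have hc : IsOpenMap circlePt := by
    have : circlePt = circlePoint ∘ fun θ : ℝ => 2 * Real.pi * θ := rfl
    rw [this]
    exact isOpenMap_circlePoint.comp (Homeomorph.mulLeft₀ (2 * Real.pi) h2π).isOpenMap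
  exact hc.prodMap IsOpenMap.id

/-- **Smoothness descends along `circlePt × id`.**  If `L ∘ (circlePt × id)` is `C^∞` at
`(s, y)` then `L : S¹ × ℝ³ → N` is `C^∞` at `(circlePt s, y)`: write
`L = (L ∘ (circlePt × id)) ∘ (ang × id)` with `ang` one of the smooth local angle functions
`angA`, `angB`, and move the base point by an integral translation. [folklore] -/
theorem contMDiffAt_of_comp_circlePt_prod {E' H' : Type*} [NormedAddCommGroup E']
    [NormedSpace ℝ E'] [TopologicalSpace H'] {J : ModelWithCorners ℝ E' H'} {N : Type*}
    [TopologicalSpace N] [ChartedSpace H' N] {L : 𝕊¹ × 𝔼 3 → N} {s : ℝ} {y : 𝔼 3}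
    (h : ContMDiffAt 𝓘(ℝ, ℝ × 𝔼 3) J ∞
      (L ∘ fun q : ℝ × 𝔼 3 => ((circlePt q.1, q.2) : 𝕊¹ × 𝔼 3)) (s, y)) :
    ContMDiffAt ((𝓡 1).prod 𝓘(ℝ, 𝔼 3)) J ∞ L (circlePt s, y) := by
  set M : ℝ × 𝔼 3 → N := L ∘ fun q : ℝ × 𝔼 3 => ((circlePt q.1, q.2) : 𝕊¹ × 𝔼 3) with hM
  have hper : ∀ (t : ℝ) (z : 𝔼 3), M (t + 1, z) = M (t, z) := fun t z => by
    simp [hM, circlePt_add_one]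
  -- smoothness of `M` at every lift of `circlePt s`
  have hlift : ∀ s' : ℝ, circlePt s' = circlePt s → ContMDiffAt 𝓘(ℝ, ℝ × 𝔼 3) J ∞ M (s', y) := by
    intro s' hs'
    obtain ⟨m, rfl⟩ := circlePt_eq_circlePt_iff.1 hs'
    have heq : M = M ∘ fun q : ℝ × 𝔼 3 => (q.1 - m, q.2) := by
      funext q
      simp only [comp_apply]
      have := apply_add_int_of_periodic hper (-m) q.1 q.2
      rw [Int.cast_neg, ← sub_eq_add_neg] at this
      exact this.symm
    rw [heq]
    refine ContMDiffAt.comp (s + m, y) ?_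
      ((contDiff_fst.sub contDiff_const).prodMk contDiff_snd).contMDiff.contMDiffAt
    have : ((s + m - m, y) : ℝ × 𝔼 3) = (s, y) := by simp
    rw [this]
    exact h
  -- through an angle function smooth at `circlePt s`
  have key : ∀ ang : 𝕊¹ → ℝ, (∀ v, circlePt (ang v) = v) →
      ContMDiffAt (𝓡 1) 𝓘(ℝ, ℝ) ∞ ang (circlePt s) →
      ContMDiffAt ((𝓡 1).prod 𝓘(ℝ, 𝔼 3)) J ∞ L (circlePt s, y) := by
    intro ang hsec hang
    have hL : L = M ∘ fun q : 𝕊¹ × 𝔼 3 => ((ang q.1, q.2) : ℝ × 𝔼 3) := by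
      funext q
      simp [hM, hsec]
    have hA : ContMDiffAt ((𝓡 1).prod 𝓘(ℝ, 𝔼 3)) 𝓘(ℝ, ℝ × 𝔼 3) ∞
        (fun q : 𝕊¹ × 𝔼 3 => ((ang q.1, q.2) : ℝ × 𝔼 3)) (circlePt s, y) :=
      (hang.comp (circlePt s, y) contMDiffAt_fst).prodMk_space contMDiffAt_snd
    rw [hL]
    exact (hlift (ang (circlePt s)) (hsec _)).comp (circlePt s, y) hA
  by_cases hsA : circlePt s = ptA
  · have hsB : circlePt s ≠ ptB := hsA ▸ ptA_ne_ptB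
    exact key angB circlePt_angB (contMDiffAt_angB hsB)
  · exact key angA circlePt_angA (contMDiffAt_angA hsA)

/-- **A smooth local left inverse makes the differential injective.**  If `B ∘ A = id` near
`p`, with `A` and `B` `C^∞` at `p` and `A p`, then `mfderiv A p` is injective (chain rule and
uniqueness of the differential). [folklore] -/
theorem mfderiv_injective_of_leftInverse {EM HM EN HN : Type*} [NormedAddCommGroup EM]
    [NormedSpace ℝ EM] [TopologicalSpace HM] {IM : ModelWithCorners ℝ EM HM}
    [NormedAddCommGroup EN] [NormedSpace ℝ EN] [TopologicalSpace HN]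
    {IN : ModelWithCorners ℝ EN HN} {M : Type*} [TopologicalSpace M] [ChartedSpace HM M]
    {N : Type*} [TopologicalSpace N] [ChartedSpace HN N] {A : M → N} {B : N → M} {p : M}
    (hA : ContMDiffAt IM IN ∞ A p) (hB : ContMDiffAt IN IM ∞ B (A p))
    (hBA : ∀ᶠ q in 𝓝 p, B (A q) = q) : Injective (mfderiv IM IN A p) := by
  have hn : (∞ : WithTop ℕ∞) ≠ 0 := by simp
  have hAd := hA.mdifferentiableAt hn
  have hBd := hB.mdifferentiableAt hn
  have hc : HasMFDerivAt IM IM (B ∘ A) p ((mfderiv IN IM B (A p)).comp (mfderiv IM IN A p)) :=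
    hBd.hasMFDerivAt.comp p hAd.hasMFDerivAt
  have hid : HasMFDerivAt IM IM (B ∘ A) p (ContinuousLinearMap.id ℝ (TangentSpace IM p)) :=
    (hasMFDerivAt_id p).congr_of_eventuallyEq (hBA.mono fun q hq => hq)
  have key := hasMFDerivAt_unique hc hid
  refine LeftInverse.injective (g := mfderiv IN IM B (A p)) fun v => ?_
  exact DFunLike.congr_fun key v

/-! ### The descended tube -/

/-- **Descending an equivariant tube reparametrisation.**  Let `ν₀ : S¹ × ℝ³ ↪ X` be a tubular
neighbourhood of a circle `e` (`CircleNbhd`), `Ψ` (`C^∞` on `ℝ × B(0, r)`, `1`-equivariant) and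
`Φ` (`C^∞` on `ℝ × B(0, ε)`, `1`-equivariant there, valued in `ℝ × B(0, r)`, with `Ψ ∘ Φ = id`
on `ℝ × B(0, ε)` and `Φ (ℝ × B(0, ε))` open).  Then there is `ν : S¹ × ℝ³ → X` with
`ν (circlePt s, y) = ν₀ (circlePt (Φ (s, y)).1, (Φ (s, y)).2)` for `‖y‖ < ε`, which on
`S¹ × B(0, ε)` is `C^∞`, injective, has open image and injective differential.
[cite: HirschDT1976, Ch. 4 §5] -/
theorem helper_foldNF_descend : ∀ (X : Type) [TopologicalSpace X] [T2Space X] [ChartedSpace (𝔼 4) X] [IsManifold (𝓡 4) ∞ X] (e : Metric.sphere (0 : 𝔼 2) 1 → X) (ν₀ : CircleNbhd (𝓡 4) e) (Ψ Φ : ℝ × 𝔼 3 → ℝ × 𝔼 3) (r ε : ℝ), 0 < r → 0 < ε → ContDiffOn ℝ ∞ Ψ (Set.univ ×ˢ Metric.ball 0 r) → ContDiffOn ℝ ∞ Φ (Set.univ ×ˢ Metric.ball 0 ε) → (∀ (t : ℝ) (x : 𝔼 3), Ψ (t + 1, x) = Ψ (t, x) + (1, 0)) → (∀ (s : ℝ)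 (y : 𝔼 3), y ∈ Metric.ball (0 : 𝔼 3) ε → Φ (s + 1, y) = Φ (s, y) + (1, 0)) → (∀ q ∈ Set.univ ×ˢ Metric.ball (0 : 𝔼 3) ε, Φ q ∈ Set.univ ×ˢ Metric.ball (0 : 𝔼 3) r ∧ Ψ (Φ q) = q) → IsOpen (Φ '' (Set.univ ×ˢ Metric.ball (0 : 𝔼 3) ε)) → ∃ ν : (Metric.sphere (0 : 𝔼 2) 1) × 𝔼 3 → X, (∀ (s : ℝ) (y : 𝔼 3), y ∈ Metric.ball (0 : 𝔼 3) ε → ν (circlePt s, y) = ν₀.toFun (circlePt (Φ (s, y)).1, (Φ (s, y)).2)) ∧ ContMDiffOn ((𝓡 1).prod 𝓘(ℝ, 𝔼 3)) (𝓡 4) ∞ ν (Set.univ ×ˢ Metric.ball 0 ε) ∧ Set.InjOn ν (Set.univ ×ˢ Metric.ball 0 ε) ∧ IsOpen (ν '' (Set.univ ×ˢ Metric.ball 0 ε)) ∧ (∀ p : (Metric.sphere (0 : 𝔼 2) 1) × 𝔼 3, p.2 ∈ Metric.ball (0 : 𝔼 3) ε → Function.Injective (mfderiv ((𝓡 1).prod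 𝓘(ℝ, 𝔼 3)) (𝓡 4) ν p)) := by
  intro X _ _ _ _ e ν₀ Ψ Φ r ε hr hε hΨ hΦ hΨper hΦper hinvr hopen
  -- the covering and the descended maps
  set Pm : ℝ × 𝔼 3 → 𝕊¹ × 𝔼 3 := fun q => (circlePt q.1, q.2) with hPm
  set G : 𝕊¹ × 𝔼 3 → 𝕊¹ × 𝔼 3 := fun p => Pm (Φ (angA p.1, p.2)) with hG
  set G' : 𝕊¹ × 𝔼 3 → 𝕊¹ × 𝔼 3 := fun p => Pm (Ψ (angA p.1, p.2)) with hG'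
  have hSo : ∀ ρ : ℝ, IsOpen ((univ : Set ℝ) ×ˢ ball (0 : 𝔼 3) ρ) := fun ρ =>
    isOpen_univ.prod isOpen_ball
  have hSo' : ∀ ρ : ℝ, IsOpen ((univ : Set 𝕊¹) ×ˢ ball (0 : 𝔼 3) ρ) := fun ρ =>
    isOpen_univ.prod isOpen_ball
  -- `G ∘ Pm = Pm ∘ Φ` on `ℝ × B(0, ε)` and `G' ∘ Pm = Pm ∘ Ψ`
  have hGPm : ∀ (s : ℝ) (y : 𝔼 3), y ∈ ball (0 : 𝔼 3) ε → G (circlePt s, y) = Pm (Φ (s, y)) := by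
    intro s y hy
    obtain ⟨m, hm⟩ := circlePt_eq_circlePt_iff.1 (circlePt_angA (circlePt s))
    simp only [hG, hm]
    rw [apply_add_int_of_equivariant_on hΦper m s hy]
    simp only [hPm, Prod.fst_add, Prod.snd_add, add_zero]
    rw [circlePt_eq_circlePt_iff.2 ⟨m, rfl⟩]
  have hG'Pm : ∀ (t : ℝ) (x : 𝔼 3), G' (circlePt t, x) = Pm (Ψ (t, x)) := by
    intro t x
    obtain ⟨m, hm⟩ := circlePt_eq_circlePt_iff.1 (circlePt_angA (circlePt t))
    simp only [hG', hm]
    rw [apply_add_int_of_equivariant_on (A := univ) (fun s y _ => hΨper s y) m t (mem_univ x)]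
    simp only [hPm, Prod.fst_add, Prod.snd_add, add_zero]
    rw [circlePt_eq_circlePt_iff.2 ⟨m, rfl⟩]
  -- `G' ∘ G = id` on `S¹ × B(0, ε)`
  have hG'G : ∀ p : 𝕊¹ × 𝔼 3, p.2 ∈ ball (0 : 𝔼 3) ε → G' (G p) = p := by
    rintro ⟨u, y⟩ hy
    obtain ⟨s, rfl⟩ : ∃ s, circlePt s = u := ⟨angA u, circlePt_angA u⟩
    rw [hGPm s y hy, show Pm (Φ (s, y)) = (circlePt (Φ (s, y)).1, (Φ (s, y)).2) from rfl, hG'Pm,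
      Prod.mk.eta, (hinvr (s, y) (mk_mem_prod (mem_univ _) hy)).2]
  -- smoothness of `G` on `S¹ × B(0, ε)` and of `G'` at the points `G p`
  have hPms : ContMDiff 𝓘(ℝ, ℝ × 𝔼 3) ((𝓡 1).prod 𝓘(ℝ, 𝔼 3)) ∞ Pm := contMDiff_circlePt_prod
  have hGs : ∀ p : 𝕊¹ × 𝔼 3, p.2 ∈ ball (0 : 𝔼 3) ε →
      ContMDiffAt ((𝓡 1).prod 𝓘(ℝ, 𝔼 3)) ((𝓡 1).prod 𝓘(ℝ, 𝔼 3)) ∞ G p := by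
    rintro ⟨u, y⟩ hy
    obtain ⟨s, rfl⟩ : ∃ s, circlePt s = u := ⟨angA u, circlePt_angA u⟩
    apply contMDiffAt_of_comp_circlePt_prod
    have hev : (G ∘ fun q : ℝ × 𝔼 3 => ((circlePt q.1, q.2) : 𝕊¹ × 𝔼 3)) =ᶠ[𝓝 (s, y)] Pm ∘ Φ := by
      filter_upwards [(hSo ε).mem_nhds (mk_mem_prod (mem_univ s) hy)] with q hq
      exact hGPm q.1 q.2 hq.2
    refine ContMDiffAt.congr_of_eventuallyEq ?_ hev
    have hΦat : ContMDiffAt 𝓘(ℝ, ℝ × 𝔼 3) 𝓘(ℝ, ℝ × 𝔼 3) ∞ Φ (s, y) := by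
      rw [contMDiffAt_iff_contDiffAt]
      exact hΦ.contDiffAt ((hSo ε).mem_nhds (mk_mem_prod (mem_univ _) hy))
    exact (hPms _).comp (s, y) hΦat
  have hG's : ∀ p : 𝕊¹ × 𝔼 3, p.2 ∈ ball (0 : 𝔼 3) ε →
      ContMDiffAt ((𝓡 1).prod 𝓘(ℝ, 𝔼 3)) ((𝓡 1).prod 𝓘(ℝ, 𝔼 3)) ∞ G' (G p) := by
    rintro ⟨u, y⟩ hy
    obtain ⟨s, rfl⟩ : ∃ s, circlePt s = u := ⟨angA u, circlePt_angA u⟩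
    rw [hGPm s y hy]
    apply contMDiffAt_of_comp_circlePt_prod
    have hev : (G' ∘ fun q : ℝ × 𝔼 3 => ((circlePt q.1, q.2) : 𝕊¹ × 𝔼 3)) = Pm ∘ Ψ :=
      funext fun q => hG'Pm q.1 q.2
    rw [hev]
    obtain ⟨hr', -⟩ := hinvr (s, y) (mk_mem_prod (mem_univ _) hy)
    have hΨat : ContMDiffAt 𝓘(ℝ, ℝ × 𝔼 3) 𝓘(ℝ, ℝ × 𝔼 3) ∞ Ψ (Φ (s, y)) := by
      rw [contMDiffAt_iff_contDiffAt]
      exact hΨ.contDiffAt ((hSo r).mem_nhds hr')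
    exact (hPms _).comp ((Φ (s, y)).1, (Φ (s, y)).2) hΨat
  -- the new tube
  refine ⟨ν₀.toFun ∘ G, fun s y hy => by rw [comp_apply, hGPm s y hy], ?_, ?_, ?_, ?_⟩
  · -- smooth
    intro p hp
    exact ((ν₀.contMDiff _).comp p (hGs p hp.2)).contMDiffWithinAt
  · -- injective
    intro p hp q hq hpq
    have h1 : G p = G q := ν₀.injective hpq
    rw [← hG'G p hp.2, ← hG'G q hq.2, h1]
  · -- open image
    have himage : (ν₀.toFun ∘ G) '' ((univ : Set 𝕊¹) ×ˢ ball (0 : 𝔼 3) ε) =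
        ν₀.toFun '' (Pm '' (Φ '' ((univ : Set ℝ) ×ˢ ball (0 : 𝔼 3) ε))) := by
      rw [image_comp]
      congr 1
      refine subset_antisymm ?_ ?_
      · rintro _ ⟨⟨u, y⟩, ⟨-, hy⟩, rfl⟩
        obtain ⟨s, rfl⟩ : ∃ s, circlePt s = u := ⟨angA u, circlePt_angA u⟩
        exact ⟨Φ (s, y), ⟨(s, y), ⟨mem_univ _, hy⟩, rfl⟩, (hGPm s y hy).symm⟩
      · rintro _ ⟨_, ⟨⟨s, y⟩, ⟨-, hy⟩, rfl⟩, rfl⟩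
        exact ⟨(circlePt s, y), ⟨mem_univ _, hy⟩, hGPm s y hy⟩
    rw [himage]
    exact ν₀.isOpenEmbedding.isOpenMap _ (isOpenMap_circlePt_prod _ hopen)
  · -- injective differential
    intro p hp
    have hνG : ContMDiffAt ((𝓡 1).prod 𝓘(ℝ, 𝔼 3)) (𝓡 4) ∞ (ν₀.toFun ∘ G) p :=
      (ν₀.contMDiff _).comp p (hGs p hp)
    -- left inverse `G' ∘ ν₀⁻¹`, smooth at the image point
    have hsymm : ContMDiffAt (𝓡 4) ((𝓡 1).prod 𝓘(ℝ, 𝔼 3)) ∞ ν₀.toHomeo.symm (ν₀.toFun (G p)) :=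
      ν₀.contMDiffOn_toHomeo_symm.contMDiffAt (ν₀.isOpen_range.mem_nhds ⟨G p, rfl⟩)
    have hB : ContMDiffAt (𝓡 4) ((𝓡 1).prod 𝓘(ℝ, 𝔼 3)) ∞ (G' ∘ ν₀.toHomeo.symm)
        ((ν₀.toFun ∘ G) p) := by
      refine ContMDiffAt.comp ((ν₀.toFun ∘ G) p) ?_ hsymm
      rw [comp_apply, ν₀.toHomeo_symm_apply]
      exact hG's p hp
    refine mfderiv_injective_of_leftInverse hνG hB ?_
    filter_upwards [(hSo' ε).mem_nhds (mk_mem_prod (mem_univ _) hp)] with q hq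
    simp only [comp_apply, ν₀.toHomeo_symm_apply]
    exact hG'G q hq.2

end Summit.SmoothPoincare4.SmoothPoincare4.Cruxes.RungOne.Sketch

end
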